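import Mathlib.Analysis.InnerProductSpace.l2Space
import Mathlib.Analysis.SpecialFunctions.Pow.Complex
import Mathlib.Analysis.SpecialFunctions.Exponential
import Mathlib.Analysis.Complex.Exponential
import Mathlib.Analysis.Analytic.OfScalars
import Mathlib.Analysis.Analytic.Uniqueness
import HarnessLib

/-!
# The `ℓ²` model of the Bergman space of a disc (bookkeeping for Voronin's denseness lemma)

Topic `Literature/NumberTheory/LFunctions`. Everything in this file is PROVED; it is the
function-space bookkeeping behind the denseness step of Voronin's universality theorem
(Steuding, *Value-Distribution of L-Functions*, §1.3 (1.17) and §5.1–5.2: Pechersky's theorem is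
applied in the Hardy/Bergman space `ℋ²_R` of a disc, and sup-norms on a smaller disc are
controlled by the Hilbert norm).

Instead of the Bergman space `A²(|s−c|<R₁)` we use its ORTHONORMAL-COORDINATE model: a function
`h(s) = ∑ a_k (s−c)^k` corresponds to the sequence `embed R₁ a = (a_k R₁^k/√(k+1))_k` in
`ℓ²(ℕ, ℂ)` (the monomials `(s−c)^k` are orthogonal in `A²` with `‖(s−c)^k‖² = π R₁^{2k+2}/(k+1)`),
so that no area integrals are needed:

* `VoroninModel.seriesOf R₁ v c s = ∑' k, v_k (√(k+1)/R₁^k) (s−c)^k` — the function attached to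
  `v ∈ ℓ²`; it converges absolutely on `|s−c| ≤ r < R₁`, is linear in `v`, and
  `|seriesOf v (s)| ≤ K(r,R₁) ‖v‖` there (`norm_seriesOf_le`), `K = ∑ √(k+1) (r/R₁)^k`;
  `seriesOf (embed a) = ∑ a_k (s−c)^k` (`seriesOf_embed`).
* `VoroninModel.pairing R₁ φ z = ∑' k, φ_k (R₁^k/(k! √(k+1))) (−z)^k` — the entire function with
  `⟨embed (coefficients of p^{−s} at c), φ⟩ = p^{−c} · pairing φ (log p)` (`inner_embed_cpow`),
  `|pairing φ z| ≤ ‖φ‖ e^{R₁|z|}` (`norm_pairing_le`), entire (`differentiable_pairing`), and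
  `pairing φ = 0 ⇒ φ = 0` (`eq_zero_of_pairing_eq_zero`). This is the function `ϱ` of Steuding's
  proof of Thm. 5.10 ((5.19)–(5.21)) in coordinates.
* `VoroninModel.cpowCoeff p c k = p^{−c} (−log p)^k / k!` — the Taylor coefficients of
  `s ↦ p^{−s}` at `c`, with `∑ cpowCoeff · (s−c)^k = p^{−s}` and
  `‖embed (cpowCoeff p c)‖² ≤ p^{−2(Re c − R₁)}` (`norm_embed_cpowCoeff_sq_le`).

## References

* [Steuding2007] J. Steuding, *Value-Distribution of L-Functions*, LNM 1877 (2007), §1.3 (the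
  Hardy space `ℋ²_R`, (1.17)), §5.2 (Thm. 5.6–5.7), §5.4 ((5.19)–(5.21)).
-/

noncomputable section

open Complex Filter Topology Real

namespace Literature.NumberTheory.LFunctions

namespace VoroninModel

/-! ### Weights and the embedding -/

/-- The weight `w_k = R₁^k / √(k+1)`: `embed` multiplies the `k`-th Taylor coefficient by `w_k`
(the `A²`-norm of the monomial, up to `√π R₁`). [cite: Steuding2007, §5.2] -/
def wt (R₁ : ℝ) (k : ℕ) : ℝ := R₁ ^ k / Real.sqrt (k + 1)

/-- `w_k > 0` for `R₁ > 0`. [folklore] -/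
theorem wt_pos {R₁ : ℝ} (hR : 0 < R₁) (k : ℕ) : 0 < wt R₁ k :=
  div_pos (pow_pos hR k) (Real.sqrt_pos.2 (by positivity))

/-- The coordinate sequence of a coefficient sequence: `(embed R₁ a)_k = a_k R₁^k/√(k+1)`.
[cite: Steuding2007, §5.2] -/
def embed (R₁ : ℝ) (a : ℕ → ℂ) : ℕ → ℂ := fun k ↦ a k * (wt R₁ k : ℂ)

/-- `embed` is additive. [folklore] -/
theorem embed_add (R₁ : ℝ) (a b : ℕ → ℂ) : embed R₁ (a + b) = embed R₁ a + embed R₁ b := by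
  funext k; simp [embed, add_mul]

/-- `embed` is homogeneous. [folklore] -/
theorem embed_smul (R₁ : ℝ) (c : ℂ) (a : ℕ → ℂ) : embed R₁ (c • a) = c • embed R₁ a := by
  funext k; simp [embed, mul_assoc]

/-- Norm of a coordinate. [folklore] -/
theorem norm_embed_apply {R₁ : ℝ} (hR : 0 < R₁) (a : ℕ → ℂ) (k : ℕ) :
    ‖embed R₁ a k‖ = ‖a k‖ * wt R₁ k := by
  rw [embed, norm_mul, Complex.norm_real, Real.norm_eq_abs, abs_of_pos (wt_pos hR k)]

/-- A coefficient sequence with a geometric bound `‖a_k‖ ≤ C/ρ^k`, `ρ > R₁`, embeds into `ℓ²`.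
[folklore] -/
theorem memℓp_embed_of_bound {R₁ ρ C : ℝ} (hR : 0 < R₁) (hρ : R₁ < ρ) {a : ℕ → ℂ}
    (ha : ∀ k, ‖a k‖ ≤ C / ρ ^ k) : Memℓp (embed R₁ a) 2 := by
  have hρ0 : 0 < ρ := hR.trans hρ
  have hC : 0 ≤ C := by
    have := (norm_nonneg (a 0)).trans (ha 0)
    simpa using this
  rw [memℓp_gen_iff (by norm_num)]
  simp only [ENNReal.toReal_ofNat, Real.rpow_two]
  -- `‖a_k w_k‖² ≤ C² (R₁/ρ)^{2k}`
  have hq : (R₁ / ρ) ^ 2 < 1 := by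
    rw [sq_lt_one_iff₀ (by positivity)]
    exact (div_lt_one hρ0).2 hρ
  have hterm : ∀ k : ℕ, ‖embed R₁ a k‖ ^ 2 ≤ C ^ 2 * ((R₁ / ρ) ^ 2) ^ k := by
    intro k
    rw [norm_embed_apply hR, mul_pow, wt, div_pow, Real.sq_sqrt (by positivity)]
    have h1 : ‖a k‖ ^ 2 ≤ (C / ρ ^ k) ^ 2 := pow_le_pow_left₀ (norm_nonneg _) (ha k) 2
    have h2 : (R₁ ^ k) ^ 2 / ((k : ℝ) + 1) ≤ (R₁ ^ k) ^ 2 :=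
      div_le_self (by positivity) (by linarith [(k.cast_nonneg : (0 : ℝ) ≤ k)])
    calc ‖a k‖ ^ 2 * ((R₁ ^ k) ^ 2 / ((k : ℝ) + 1)) ≤ (C / ρ ^ k) ^ 2 * (R₁ ^ k) ^ 2 :=
          mul_le_mul h1 h2 (by positivity) (by positivity)
      _ = C ^ 2 * ((R₁ / ρ) ^ 2) ^ k := by
          have hρne : ρ ≠ 0 := hρ0.ne'
          rw [← pow_mul, div_pow, ← pow_mul, ← pow_mul]
          field_simp
          rw [mul_comm 2 k, div_pow]
          field_simp
  exact Summable.of_nonneg_of_le (fun k ↦ sq_nonneg _) hterm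
    ((summable_geometric_of_lt_one (by positivity) hq).mul_left (C ^ 2))

/-! ### The function attached to an `ℓ²` sequence -/

/-- The comparison constant `K(r, R₁) = ∑ √(k+1) (r/R₁)^k` (finite for `0 ≤ r < R₁`).
[folklore] -/
def supConst (r R₁ : ℝ) : ℝ := ∑' k : ℕ, Real.sqrt (k + 1) * (r / R₁) ^ k

/-- Summability of `√(k+1) q^k` for `0 ≤ q < 1` (compare with `(k+1) q^k`). [folklore] -/
theorem summable_sqrt_mul_pow {q : ℝ} (hq0 : 0 ≤ q) (hq : q < 1) :
    Summable (fun k : ℕ ↦ Real.sqrt (k + 1) * q ^ k) := by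
  have h := (summable_pow_mul_geometric_of_norm_lt_one 1 (by rwa [Real.norm_eq_abs, abs_of_nonneg hq0]) :
    Summable (fun k : ℕ ↦ (k : ℝ) ^ 1 * q ^ k))
  have h2 : Summable (fun k : ℕ ↦ ((k : ℝ) + 1) * q ^ k) := by
    simp only [pow_one] at h
    simpa [add_mul] using h.add (summable_geometric_of_lt_one hq0 hq)
  refine Summable.of_nonneg_of_le (fun k ↦ by positivity) (fun k ↦ ?_) h2
  gcongr
  rw [Real.sqrt_le_left (by positivity)]
  nlinarith [(k.cast_nonneg : (0 : ℝ) ≤ k)]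

/-- `K(r,R₁) ≥ 0`. [folklore] -/
theorem supConst_nonneg {r R₁ : ℝ} (hr : 0 ≤ r) (hR : 0 < R₁) : 0 ≤ supConst r R₁ :=
  tsum_nonneg fun k ↦ by positivity

/-- The function `s ↦ ∑' k, v_k (√(k+1)/R₁^k) (s − c)^k` attached to `v ∈ ℓ²(ℕ, ℂ)` (the inverse
of `embed` on coefficient sequences, `seriesOf_embed`). [cite: Steuding2007, §5.2] -/
def seriesOf (R₁ : ℝ) (v : lp (fun _ : ℕ ↦ ℂ) 2) (c s : ℂ) : ℂ :=
  ∑' k : ℕ, (v : ℕ → ℂ) k * ((wt R₁ k)⁻¹ : ℝ) * (s - c) ^ k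

/-- Termwise bound: `‖v_k w_k⁻¹ (s−c)^k‖ ≤ ‖v‖ √(k+1) (r/R₁)^k` for `‖s − c‖ ≤ r`. [folklore] -/
theorem norm_term_le {R₁ r : ℝ} (hR : 0 < R₁) (v : lp (fun _ : ℕ ↦ ℂ) 2) {c s : ℂ}
    (hs : ‖s - c‖ ≤ r) (k : ℕ) :
    ‖(v : ℕ → ℂ) k * ((wt R₁ k)⁻¹ : ℝ) * (s - c) ^ k‖ ≤ ‖v‖ * (Real.sqrt (k + 1) * (r / R₁) ^ k) := by
  rw [norm_mul, norm_mul, Complex.norm_real, Real.norm_eq_abs, abs_of_pos (inv_pos.2 (wt_pos hR k)),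
    norm_pow, wt, inv_div, div_pow]
  have h1 : ‖(v : ℕ → ℂ) k‖ ≤ ‖v‖ := lp.norm_apply_le_norm (by norm_num) v k
  have h2 : ‖s - c‖ ^ k ≤ r ^ k := pow_le_pow_left₀ (norm_nonneg _) hs k
  have hRk : 0 < R₁ ^ k := pow_pos hR k
  calc ‖(v : ℕ → ℂ) k‖ * (Real.sqrt (k + 1) / R₁ ^ k) * ‖s - c‖ ^ k
      ≤ ‖v‖ * (Real.sqrt (k + 1) / R₁ ^ k) * r ^ k := by gcongr
    _ = ‖v‖ * (Real.sqrt (k + 1) * (r ^ k / R₁ ^ k)) := by ring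

/-- Absolute convergence of `seriesOf` on `|s − c| ≤ r < R₁`. [folklore] -/
theorem summable_term {R₁ r : ℝ} (hR : 0 < R₁) (hr : 0 ≤ r) (hrR : r < R₁)
    (v : lp (fun _ : ℕ ↦ ℂ) 2) {c s : ℂ} (hs : ‖s - c‖ ≤ r) :
    Summable (fun k : ℕ ↦ (v : ℕ → ℂ) k * ((wt R₁ k)⁻¹ : ℝ) * (s - c) ^ k) :=
  Summable.of_norm_bounded (g := fun k : ℕ ↦ ‖v‖ * (Real.sqrt (k + 1) * (r / R₁) ^ k))
    ((summable_sqrt_mul_pow (div_nonneg hr hR.le) ((div_lt_one hR).2 hrR)).mul_left _)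
    (norm_term_le hR v hs)

/-- **Sup-norm versus `ℓ²`-norm** (the Bergman-space inequality in coordinates): for
`‖s − c‖ ≤ r < R₁`, `‖seriesOf v (s)‖ ≤ K(r,R₁) ‖v‖`. [cite: Steuding2007, §5.2] -/
theorem norm_seriesOf_le {R₁ r : ℝ} (hR : 0 < R₁) (hr : 0 ≤ r) (hrR : r < R₁)
    (v : lp (fun _ : ℕ ↦ ℂ) 2) {c s : ℂ} (hs : ‖s - c‖ ≤ r) :
    ‖seriesOf R₁ v c s‖ ≤ supConst r R₁ * ‖v‖ := by
  have hsum := summable_sqrt_mul_pow (div_nonneg hr hR.le) ((div_lt_one hR).2 hrR)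
  calc ‖seriesOf R₁ v c s‖ ≤ ∑' k : ℕ, ‖v‖ * (Real.sqrt (k + 1) * (r / R₁) ^ k) :=
        tsum_of_norm_bounded (hsum.mul_left _).hasSum (norm_term_le hR v hs)
    _ = supConst r R₁ * ‖v‖ := by rw [tsum_mul_left, supConst, mul_comm]

/-- `seriesOf` is additive in `v` (on the disc of convergence). [folklore] -/
theorem seriesOf_add {R₁ r : ℝ} (hR : 0 < R₁) (hr : 0 ≤ r) (hrR : r < R₁)
    (v w : lp (fun _ : ℕ ↦ ℂ) 2) {c s : ℂ} (hs : ‖s - c‖ ≤ r) :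
    seriesOf R₁ (v + w) c s = seriesOf R₁ v c s + seriesOf R₁ w c s := by
  simp only [seriesOf]
  rw [← (summable_term hR hr hrR v hs).tsum_add (summable_term hR hr hrR w hs)]
  refine tsum_congr fun k ↦ ?_
  simp only [lp.coeFn_add, Pi.add_apply]
  ring

/-- `seriesOf` is subtractive in `v`. [folklore] -/
theorem seriesOf_sub {R₁ r : ℝ} (hR : 0 < R₁) (hr : 0 ≤ r) (hrR : r < R₁)
    (v w : lp (fun _ : ℕ ↦ ℂ) 2) {c s : ℂ} (hs : ‖s - c‖ ≤ r) :
    seriesOf R₁ (v - w) c s = seriesOf R₁ v c s - seriesOf R₁ w c s := by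
  simp only [seriesOf]
  rw [← (summable_term hR hr hrR v hs).tsum_sub (summable_term hR hr hrR w hs)]
  refine tsum_congr fun k ↦ ?_
  simp only [lp.coeFn_sub, Pi.sub_apply]
  ring

/-- `seriesOf` is homogeneous in `v`. [folklore] -/
theorem seriesOf_smul (R₁ : ℝ) (a : ℂ) (v : lp (fun _ : ℕ ↦ ℂ) 2) (c s : ℂ) :
    seriesOf R₁ (a • v) c s = a * seriesOf R₁ v c s := by
  simp only [seriesOf]
  rw [← tsum_mul_left]
  refine tsum_congr fun k ↦ ?_
  simp only [lp.coeFn_smul, Pi.smul_apply, smul_eq_mul]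
  ring

/-- `seriesOf` of a finite sum. [folklore] -/
theorem seriesOf_finset_sum {R₁ r : ℝ} (hR : 0 < R₁) (hr : 0 ≤ r) (hrR : r < R₁) {ι : Type*}
    (t : Finset ι) (v : ι → lp (fun _ : ℕ ↦ ℂ) 2) {c s : ℂ} (hs : ‖s - c‖ ≤ r) :
    seriesOf R₁ (∑ i ∈ t, v i) c s = ∑ i ∈ t, seriesOf R₁ (v i) c s := by
  classical
  induction t using Finset.induction_on with
  | empty => simp [seriesOf]
  | insert i t hi ih => rw [Finset.sum_insert hi, Finset.sum_insert hi, seriesOf_add hR hr hrR _ _ hs, ih]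

/-- `seriesOf ∘ embed` recovers the power series `∑ a_k (s−c)^k`. [folklore] -/
theorem seriesOf_embed {R₁ : ℝ} (hR : 0 < R₁) {a : ℕ → ℂ} (ha : Memℓp (embed R₁ a) 2) (c s : ℂ) :
    seriesOf R₁ ⟨embed R₁ a, ha⟩ c s = ∑' k : ℕ, a k * (s - c) ^ k := by
  simp only [seriesOf]
  refine tsum_congr fun k ↦ ?_
  change embed R₁ a k * _ * _ = _
  rw [embed]
  have hw : (wt R₁ k : ℂ) ≠ 0 := by exact_mod_cast (wt_pos hR k).ne'
  push_cast
  field_simp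

/-! ### The vectors attached to `p^{-s}` -/

/-- The Taylor coefficients of `s ↦ p^{-s}` at the centre `c`:
`p^{-s} = p^{-c} e^{-(s-c) log p} = ∑_k p^{-c} (−log p)^k/k! · (s−c)^k`. [folklore] -/
def cpowCoeff (p : ℕ) (c : ℂ) (k : ℕ) : ℂ :=
  (p : ℂ) ^ (-c) * (-(Real.log p : ℂ)) ^ k / (k.factorial : ℂ)

/-- `∑_k cpowCoeff p c k (s−c)^k = p^{-s}` (`p ≥ 1`). [folklore] -/
theorem hasSum_cpowCoeff {p : ℕ} (hp : 0 < p) (c s : ℂ) :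
    HasSum (fun k : ℕ ↦ cpowCoeff p c k * (s - c) ^ k) ((p : ℂ) ^ (-s)) := by
  have hp0 : (p : ℂ) ≠ 0 := by exact_mod_cast hp.ne'
  -- `p^{-s} = p^{-c} · exp (-(s-c) log p)`
  have hsplit : (p : ℂ) ^ (-s) = (p : ℂ) ^ (-c) * cexp (-(s - c) * (Real.log p : ℂ)) := by
    rw [show -s = -c + (-(s - c)) by ring, Complex.cpow_add _ _ hp0]
    congr 1
    rw [Complex.cpow_def_of_ne_zero hp0, ← Complex.natCast_log]
    ring_nf
  rw [hsplit]
  have hexp : HasSum (fun k : ℕ ↦ (-(s - c) * (Real.log p : ℂ)) ^ k / (k.factorial : ℂ))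
      (cexp (-(s - c) * (Real.log p : ℂ))) := by
    rw [Complex.exp_eq_exp_ℂ]
    exact NormedSpace.expSeries_div_hasSum_exp _
  refine (hexp.mul_left ((p : ℂ) ^ (-c))).congr_fun fun k ↦ ?_
  simp only [cpowCoeff]
  rw [show -(s - c) * (Real.log p : ℂ) = (-(Real.log p : ℂ)) * (s - c) by ring, mul_pow]
  ring

/-- `‖cpowCoeff p c k‖ = p^{-Re c} (log p)^k / k!` for `p ≥ 1`. [folklore] -/
theorem norm_cpowCoeff {p : ℕ} (hp : 0 < p) (c : ℂ) (k : ℕ) :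
    ‖cpowCoeff p c k‖ = (p : ℝ) ^ (-c.re) * Real.log p ^ k / k.factorial := by
  have hlog : 0 ≤ Real.log p := Real.log_nonneg (by exact_mod_cast hp)
  rw [cpowCoeff, norm_div, norm_mul, Complex.norm_natCast_cpow_of_pos hp, norm_pow, norm_neg,
    Complex.norm_real, Real.norm_eq_abs, abs_of_nonneg hlog, Complex.norm_natCast, Complex.neg_re]

/-- Geometric bound for the coefficients: `‖cpowCoeff p c k‖ ≤ p^{-Re c} e^{ρ log p} / ρ^k` for every
`ρ > 0` (from `x^k/k! ≤ e^x`). [folklore] -/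
theorem norm_cpowCoeff_le {p : ℕ} (hp : 0 < p) (c : ℂ) {ρ : ℝ} (hρ : 0 < ρ) (k : ℕ) :
    ‖cpowCoeff p c k‖ ≤ (p : ℝ) ^ (-c.re) * Real.exp (ρ * Real.log p) / ρ ^ k := by
  have hlog : 0 ≤ Real.log p := Real.log_nonneg (by exact_mod_cast hp)
  rw [norm_cpowCoeff hp, mul_div_assoc, mul_div_assoc]
  refine mul_le_mul_of_nonneg_left ?_ (by positivity)
  rw [div_le_div_iff₀ (by positivity) (by positivity)]
  have h := Real.pow_div_factorial_le_exp (hx := mul_nonneg hρ.le hlog) (n := k)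
  rw [div_le_iff₀ (by positivity), mul_pow] at h
  linarith

/-- The coefficient sequence of `p^{-s}` embeds into `ℓ²` (any `R₁ > 0`). [folklore] -/
theorem memℓp_embed_cpowCoeff {R₁ : ℝ} (hR : 0 < R₁) {p : ℕ} (hp : 0 < p) (c : ℂ) :
    Memℓp (embed R₁ (cpowCoeff p c)) 2 :=
  memℓp_embed_of_bound hR (lt_add_one R₁) (fun k ↦ norm_cpowCoeff_le hp c (by linarith) k)

/-- The `ℓ²` vector attached to `s ↦ p^{-s}` (centre `c`, radius `R₁`).
[cite: Steuding2007, §1.3 (the terms `u_k`)] -/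
def cpowVec (R₁ : ℝ) (hR : 0 < R₁) (p : ℕ) (hp : 0 < p) (c : ℂ) : lp (fun _ : ℕ ↦ ℂ) 2 :=
  ⟨embed R₁ (cpowCoeff p c), memℓp_embed_cpowCoeff hR hp c⟩

/-- Coordinates of `cpowVec`. [folklore] -/
theorem cpowVec_apply {R₁ : ℝ} (hR : 0 < R₁) {p : ℕ} (hp : 0 < p) (c : ℂ) (k : ℕ) :
    (cpowVec R₁ hR p hp c : ℕ → ℂ) k = cpowCoeff p c k * (wt R₁ k : ℂ) := rfl

/-- `seriesOf (cpowVec p) = p^{-s}`. [folklore] -/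
theorem seriesOf_cpowVec {R₁ : ℝ} (hR : 0 < R₁) {p : ℕ} (hp : 0 < p) (c s : ℂ) :
    seriesOf R₁ (cpowVec R₁ hR p hp c) c s = (p : ℂ) ^ (-s) := by
  rw [cpowVec, seriesOf_embed hR, (hasSum_cpowCoeff hp c s).tsum_eq]

/-- **Summability of `‖u_p‖²`** (hypothesis (i) of Pechersky's theorem, Steuding §1.3/(5.9)):
`‖cpowVec p‖² ≤ p^{-2(Re c − R₁)}`. Indeed `∑_k p^{-2Re c} (log p)^{2k} R₁^{2k}/((k!)²(k+1))`
`≤ p^{-2Re c} e^{R₁ log p} ∑_k (R₁ log p)^k/k! = p^{-2Re c + 2R₁}`. [cite: Steuding2007, Thm. 5.7 (5.9)] -/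
theorem norm_cpowVec_sq_le {R₁ : ℝ} (hR : 0 < R₁) {p : ℕ} (hp : 0 < p) (c : ℂ) :
    ‖cpowVec R₁ hR p hp c‖ ^ 2 ≤ (p : ℝ) ^ (-2 * (c.re - R₁)) := by
  have hlog : 0 ≤ Real.log p := Real.log_nonneg (by exact_mod_cast hp)
  have hp' : (0 : ℝ) < p := by exact_mod_cast hp
  set x : ℝ := R₁ * Real.log p with hx
  have hx0 : 0 ≤ x := mul_nonneg hR.le hlog
  -- the norm squared as a series
  have hnorm : ‖cpowVec R₁ hR p hp c‖ ^ 2 = ∑' k : ℕ, ‖(cpowVec R₁ hR p hp c : ℕ → ℂ) k‖ ^ 2 := by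
    have h := lp.norm_rpow_eq_tsum (by norm_num : 0 < (2 : ENNReal).toReal) (cpowVec R₁ hR p hp c)
    simp only [ENNReal.toReal_ofNat, Real.rpow_two] at h
    exact h
  -- termwise bound by the exponential series
  have hterm : ∀ k : ℕ, ‖(cpowVec R₁ hR p hp c : ℕ → ℂ) k‖ ^ 2 ≤
      ((p : ℝ) ^ (-c.re)) ^ 2 * Real.exp x * (x ^ k / k.factorial) := by
    intro k
    rw [cpowVec_apply, norm_mul, Complex.norm_real, Real.norm_eq_abs, abs_of_pos (wt_pos hR k),
      norm_cpowCoeff hp, wt]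
    have hsq : ((p : ℝ) ^ (-c.re) * Real.log p ^ k / k.factorial * (R₁ ^ k / Real.sqrt (k + 1))) ^ 2
        = ((p : ℝ) ^ (-c.re)) ^ 2 * (x ^ k / k.factorial) ^ 2 / (Real.sqrt (k + 1)) ^ 2 := by
      rw [hx, mul_pow R₁]; field_simp
    rw [hsq, Real.sq_sqrt (by positivity)]
    have h1 : (x ^ k / k.factorial) ^ 2 / ((k : ℝ) + 1) ≤ (x ^ k / k.factorial) ^ 2 :=
      div_le_self (by positivity) (by linarith [(k.cast_nonneg : (0 : ℝ) ≤ k)])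
    have h2 : (x ^ k / k.factorial) ^ 2 ≤ Real.exp x * (x ^ k / k.factorial) := by
      rw [sq]
      exact mul_le_mul_of_nonneg_right (Real.pow_div_factorial_le_exp (hx := hx0) (n := k))
        (by positivity)
    calc ((p : ℝ) ^ (-c.re)) ^ 2 * (x ^ k / k.factorial) ^ 2 / ((k : ℝ) + 1)
        = ((p : ℝ) ^ (-c.re)) ^ 2 * ((x ^ k / k.factorial) ^ 2 / ((k : ℝ) + 1)) := by ring
      _ ≤ ((p : ℝ) ^ (-c.re)) ^ 2 * (Real.exp x * (x ^ k / k.factorial)) := by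
          gcongr; exact h1.trans h2
      _ = ((p : ℝ) ^ (-c.re)) ^ 2 * Real.exp x * (x ^ k / k.factorial) := by ring
  have hexp : HasSum (fun k : ℕ ↦ x ^ k / k.factorial) (Real.exp x) := by
    rw [Real.exp_eq_exp_ℝ]
    exact NormedSpace.expSeries_div_hasSum_exp x
  have hmaj := hexp.mul_left (((p : ℝ) ^ (-c.re)) ^ 2 * Real.exp x)
  rw [hnorm]
  calc ∑' k : ℕ, ‖(cpowVec R₁ hR p hp c : ℕ → ℂ) k‖ ^ 2
      ≤ ∑' k : ℕ, ((p : ℝ) ^ (-c.re)) ^ 2 * Real.exp x * (x ^ k / k.factorial) :=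
        (Summable.of_nonneg_of_le (fun k ↦ sq_nonneg _) hterm hmaj.summable).tsum_le_tsum hterm
          hmaj.summable
    _ = ((p : ℝ) ^ (-c.re)) ^ 2 * Real.exp x * Real.exp x := hmaj.tsum_eq
    _ = (p : ℝ) ^ (-2 * (c.re - R₁)) := by
        have h1 : ((p : ℝ) ^ (-c.re)) ^ 2 = (p : ℝ) ^ (-2 * c.re) := by
          rw [← Real.rpow_natCast, ← Real.rpow_mul hp'.le]; ring_nf
        have h2 : Real.exp x * Real.exp x = (p : ℝ) ^ (2 * R₁) := by
          rw [← Real.exp_add, hx, ← two_mul, Real.rpow_def_of_pos hp']; ring_nf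
        rw [mul_assoc, h1, h2, ← Real.rpow_add hp']
        ring_nf

/-! ### The pairing function `ϱ_φ` -/

/-- The weights `R₁^k/(k! √(k+1))` of the pairing function. [folklore] -/
def pairWt (R₁ : ℝ) (k : ℕ) : ℝ := R₁ ^ k / (k.factorial * Real.sqrt (k + 1))

/-- `pairWt > 0`. [folklore] -/
theorem pairWt_pos {R₁ : ℝ} (hR : 0 < R₁) (k : ℕ) : 0 < pairWt R₁ k :=
  div_pos (pow_pos hR k) (mul_pos (by positivity) (Real.sqrt_pos.2 (by positivity)))

/-- `pairWt R₁ k ≤ R₁^k / k!`. [folklore] -/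
theorem pairWt_le {R₁ : ℝ} (hR : 0 < R₁) (k : ℕ) : pairWt R₁ k ≤ R₁ ^ k / k.factorial := by
  rw [pairWt]
  refine div_le_div_of_nonneg_left (pow_nonneg hR.le k) (by positivity) ?_
  have hk1 : (1 : ℝ) ≤ Real.sqrt (k + 1) := by
    rw [Real.le_sqrt (by norm_num) (by positivity)]
    linarith [(k.cast_nonneg : (0 : ℝ) ≤ k)]
  nlinarith [(Nat.cast_pos.2 (Nat.factorial_pos k) : (0 : ℝ) < k.factorial)]

/-- The Taylor coefficients `β_k = φ_k · R₁^k/(k!√(k+1)) · (−1)^k` of the pairing function of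
`φ ∈ ℓ²`. [cite: Steuding2007, §5.4 (5.19)–(5.21)] -/
def pairCoeff (R₁ : ℝ) (φ : lp (fun _ : ℕ ↦ ℂ) 2) (k : ℕ) : ℂ :=
  (φ : ℕ → ℂ) k * (pairWt R₁ k : ℂ) * (-1) ^ k

/-- `‖β_k‖ ≤ ‖φ‖ R₁^k/k!`. [folklore] -/
theorem norm_pairCoeff_le {R₁ : ℝ} (hR : 0 < R₁) (φ : lp (fun _ : ℕ ↦ ℂ) 2) (k : ℕ) :
    ‖pairCoeff R₁ φ k‖ ≤ ‖φ‖ * (R₁ ^ k / k.factorial) := by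
  rw [pairCoeff, norm_mul, norm_mul, norm_pow, norm_neg, norm_one, one_pow, mul_one,
    Complex.norm_real, Real.norm_eq_abs, abs_of_pos (pairWt_pos hR k)]
  exact mul_le_mul (lp.norm_apply_le_norm (by norm_num) φ k) (pairWt_le hR k) (pairWt_pos hR k).le
    (norm_nonneg _)

/-- The formal power series `∑ β_k z^k` of the pairing function. [folklore] -/
def pairSeries (R₁ : ℝ) (φ : lp (fun _ : ℕ ↦ ℂ) 2) : FormalMultilinearSeries ℂ ℂ ℂ :=
  FormalMultilinearSeries.ofScalars ℂ (pairCoeff R₁ φ)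

/-- The pairing series has infinite radius of convergence (`‖β_k‖ r^k ≤ ‖φ‖ e^{R₁ r}`). [folklore] -/
theorem radius_pairSeries {R₁ : ℝ} (hR : 0 < R₁) (φ : lp (fun _ : ℕ ↦ ℂ) 2) :
    (pairSeries R₁ φ).radius = ⊤ := by
  refine ENNReal.eq_top_of_forall_nnreal_le fun r ↦ ?_
  refine (pairSeries R₁ φ).le_radius_of_bound (‖φ‖ * Real.exp (R₁ * r)) fun k ↦ ?_
  rw [pairSeries, FormalMultilinearSeries.ofScalars_norm]
  have h1 := norm_pairCoeff_le hR φ k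
  have h2 : (R₁ * r) ^ k / k.factorial ≤ Real.exp (R₁ * r) :=
    Real.pow_div_factorial_le_exp (hx := by positivity) (n := k)
  calc ‖pairCoeff R₁ φ k‖ * (r : ℝ) ^ k ≤ ‖φ‖ * (R₁ ^ k / k.factorial) * (r : ℝ) ^ k := by gcongr
    _ = ‖φ‖ * ((R₁ * r) ^ k / k.factorial) := by rw [mul_pow]; ring
    _ ≤ ‖φ‖ * Real.exp (R₁ * r) := by gcongr

/-- **The pairing function** `ϱ_φ(z) = ∑_k φ_k (R₁^k/(k!√(k+1))) (−z)^k` of `φ ∈ ℓ²` — Steuding's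
`ϱ(z) = ∫ e^{-sz} dμ(s)` ((5.21)) in the coordinates of the model: `⟨u_p, φ⟩ = p^{-σ₀} ϱ_φ(log p)`
(`inner_cpowVec`). [cite: Steuding2007, §5.4 (5.19)–(5.21)] -/
def pairing (R₁ : ℝ) (φ : lp (fun _ : ℕ ↦ ℂ) 2) (z : ℂ) : ℂ := (pairSeries R₁ φ).sum z

/-- `ϱ_φ(z) = ∑' β_k z^k`. [folklore] -/
theorem pairing_eq_tsum (R₁ : ℝ) (φ : lp (fun _ : ℕ ↦ ℂ) 2) (z : ℂ) :
    pairing R₁ φ z = ∑' k : ℕ, pairCoeff R₁ φ k * z ^ k := by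
  rw [pairing, pairSeries]
  have h := FormalMultilinearSeries.ofScalars_sum_eq (E := ℂ) (pairCoeff R₁ φ) z
  rw [FormalMultilinearSeries.ofScalarsSum] at h
  rw [h]
  simp [smul_eq_mul]

/-- `ϱ_φ` is the sum of its power series on all of `ℂ`. [folklore] -/
theorem hasFPowerSeriesOnBall_pairing {R₁ : ℝ} (hR : 0 < R₁) (φ : lp (fun _ : ℕ ↦ ℂ) 2) :
    HasFPowerSeriesOnBall (pairing R₁ φ) (pairSeries R₁ φ) 0 ⊤ := by
  have h := (pairSeries R₁ φ).hasFPowerSeriesOnBall (by rw [radius_pairSeries hR]; exact ENNReal.zero_lt_top)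
  rw [radius_pairSeries hR] at h
  exact h

/-- `ϱ_φ` is entire. [cite: Steuding2007, Lemma 5.8] -/
theorem differentiable_pairing {R₁ : ℝ} (hR : 0 < R₁) (φ : lp (fun _ : ℕ ↦ ℂ) 2) :
    Differentiable ℂ (pairing R₁ φ) := fun z ↦
  have hz : z ∈ Metric.eball (0 : ℂ) ⊤ := Metric.mem_eball.2 (edist_lt_top z 0)
  ((hasFPowerSeriesOnBall_pairing hR φ).differentiableOn z hz).differentiableAt
    (Metric.isOpen_eball.mem_nhds hz)

/-- **Exponential type**: `‖ϱ_φ(z)‖ ≤ ‖φ‖ e^{R₁ |z|}`. [cite: Steuding2007, Lemma 5.8] -/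
theorem norm_pairing_le {R₁ : ℝ} (hR : 0 < R₁) (φ : lp (fun _ : ℕ ↦ ℂ) 2) (z : ℂ) :
    ‖pairing R₁ φ z‖ ≤ ‖φ‖ * Real.exp (R₁ * ‖z‖) := by
  rw [pairing_eq_tsum]
  have hexp : HasSum (fun k : ℕ ↦ (R₁ * ‖z‖) ^ k / k.factorial) (Real.exp (R₁ * ‖z‖)) := by
    rw [Real.exp_eq_exp_ℝ]
    exact NormedSpace.expSeries_div_hasSum_exp _
  refine tsum_of_norm_bounded (hexp.mul_left ‖φ‖) fun k ↦ ?_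
  rw [norm_mul, norm_pow]
  calc ‖pairCoeff R₁ φ k‖ * ‖z‖ ^ k ≤ ‖φ‖ * (R₁ ^ k / k.factorial) * ‖z‖ ^ k := by
        gcongr; exact norm_pairCoeff_le hR φ k
    _ = ‖φ‖ * ((R₁ * ‖z‖) ^ k / k.factorial) := by rw [mul_pow]; ring

/-- **Non-degeneracy**: `ϱ_φ ≡ 0` only for `φ = 0`. [folklore] -/
theorem eq_zero_of_pairing_eq_zero {R₁ : ℝ} (hR : 0 < R₁) {φ : lp (fun _ : ℕ ↦ ℂ) 2}
    (h : ∀ z, pairing R₁ φ z = 0) : φ = 0 := by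
  have hser : pairSeries R₁ φ = 0 := by
    have h1 : HasFPowerSeriesOnBall (0 : ℂ → ℂ) (pairSeries R₁ φ) 0 ⊤ :=
      (hasFPowerSeriesOnBall_pairing hR φ).congr fun z _ ↦ h z
    exact h1.hasFPowerSeriesAt.eq_zero
  have hcoeff : pairCoeff R₁ φ = 0 := by
    rw [pairSeries] at hser
    exact (FormalMultilinearSeries.ofScalars_series_eq_zero (E := ℂ)).1 hser
  refine lp.ext (funext fun k ↦ ?_)
  rw [lp.coeFn_zero, Pi.zero_apply]
  have hk : pairCoeff R₁ φ k = 0 := by rw [hcoeff, Pi.zero_apply]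
  have hw : (pairWt R₁ k : ℂ) ≠ 0 := by exact_mod_cast (pairWt_pos hR k).ne'
  have h1 : ((-1 : ℂ)) ^ k ≠ 0 := pow_ne_zero _ (by norm_num)
  unfold pairCoeff at hk
  exact (mul_eq_zero.1 ((mul_eq_zero.1 hk).resolve_right h1)).resolve_right hw

/-- Coordinates of `u_p` at a REAL centre `σ₀` are real:
`(u_p)_k = p^{-σ₀} (−log p)^k/k! · R₁^k/√(k+1)`. [folklore] -/
theorem cpowVec_apply_ofReal {R₁ : ℝ} (hR : 0 < R₁) {p : ℕ} (hp : 0 < p) (σ₀ : ℝ) (k : ℕ) :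
    (cpowVec R₁ hR p hp σ₀ : ℕ → ℂ) k =
      (((p : ℝ) ^ (-σ₀) * (-Real.log p) ^ k / k.factorial * wt R₁ k : ℝ) : ℂ) := by
  rw [cpowVec_apply, cpowCoeff]
  have h1 : (((p : ℝ) ^ (-σ₀) : ℝ) : ℂ) = (p : ℂ) ^ (-(σ₀ : ℂ)) := by
    rw [Complex.ofReal_cpow (Nat.cast_nonneg p), Complex.ofReal_natCast, Complex.ofReal_neg]
  push_cast
  rw [h1]

/-- **The pairing identity** `⟨u_p, φ⟩ = p^{-σ₀} ϱ_φ(log p)` (Steuding (5.19)–(5.21):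
`∫ h_p dμ = b̂(p) ϱ(log p)`, here in `ℓ²` coordinates with Mathlib's convention
`⟪x, y⟫ = ∑ conj(x_k) y_k`). [cite: Steuding2007, §5.4 (5.21)] -/
theorem inner_cpowVec {R₁ : ℝ} (hR : 0 < R₁) {p : ℕ} (hp : 0 < p) (σ₀ : ℝ)
    (φ : lp (fun _ : ℕ ↦ ℂ) 2) :
    inner ℂ (cpowVec R₁ hR p hp σ₀) φ = (((p : ℝ) ^ (-σ₀) : ℝ) : ℂ) * pairing R₁ φ (Real.log p) := by
  rw [lp.inner_eq_tsum, pairing_eq_tsum, ← tsum_mul_left]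
  refine tsum_congr fun k ↦ ?_
  rw [RCLike.inner_apply, cpowVec_apply_ofReal hR hp, Complex.conj_ofReal, pairCoeff, wt, pairWt]
  have hfac : (k.factorial : ℂ) ≠ 0 := by exact_mod_cast (Nat.factorial_pos k).ne'
  have hsq : (Real.sqrt (k + 1) : ℂ) ≠ 0 := by
    exact_mod_cast (Real.sqrt_pos.2 (by positivity : (0 : ℝ) < k + 1)).ne'
  push_cast
  field_simp
  ring

end VoroninModel

end Literature.NumberTheory.LFunctions
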